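import Literature.IUT.HodgeTheaters.GlobalFrobenioidsInfKappa
import Literature.IUT.HodgeTheaters.GlobalFrobenioidsArithmeticPullback
import Literature.IUT.HodgeTheaters.GlobalFrobenioidsFmodFrobenioid
import HarnessLib

/-!
# [IUTchI] Ex 5.1 (v) — NON-VACUITY of `PrimeLabelling` ("`Prime(†ℱ^⊛_mod) ⥲ 𝕍_mod`") at the arithmetic models (row «NV-L5/PrimeLabelling»)

Mochizuki, *Inter-universal Teichmüller theory I*, kurims manuscript (May 2020), Example 5.1 (v), p. 129
l. 52–62: "In particular, we obtain a purely category-theoretic construction, from the category `†ℱ^⊛`, of the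
natural bijection `Prime(†ℱ^⊛_mod) ⥲ 𝕍_mod` — where we write `Prime(†ℱ^⊛_mod)` for the set of primes [cf. [FrdI],
§0] of the divisor monoid of `†ℱ^⊛_mod`; we think of `𝕍_mod` as the set of `π₁(†𝒟^⊛)`-orbits of `𝕍(†𝒟^⊚)`."
([IUTchI] Ex 5.1 (v) p.129) [claim: Mochizuki2012, status: disputed]

PROOF-ONLY companion (no `def`, no `instance`, no `structure`) of abc-iut-L5-t1's `GlobalFrobenioidsInfKappa.lean`
(`PrimeLabelling Δ Vmod` = a terminal object `A₀` of `†𝒟^⊛` + a bijection `Δ.PrimeAt A₀ ≃ Vmod`, DATA).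
abc-iut-w5-d197's INHABITATION CENSUS L5 v1 lists `PrimeLabelling` with ZERO producers.  This file records,
kernel-checked and BY NAME over landed producers only:

* `PrimeLabelling.nonempty_model_at` — GENUINE MODEL: over the arithmetic divisor data
  `GlobalDivisorData.arith F` on `†𝒟^⊛ = ℬ(G_F)⁰` (abc-iut-w4-d050; [FrdI] Ex 6.3 data of abc-iut-L1 along the Galois
  correspondence), at EVERY terminal object `A₀` ("`C_{F_mod}`"), the interface is inhabited with
  `𝕍_mod :=` the places of the number field of `A₀`, the bijection being abc-iut-L1's [FrdI] Ex 6.3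
  `Ex63_primes_holds` ("`v ↦` the prime of `[v]`") read backwards (`arith_primes_terminal`);
* `PrimeLabelling.exists_model` — … and terminal objects EXIST (`exists_isTerminal_baseCat`, the one-point
  `G_F`-set), their number field being `F = F_mod` itself (`arith_field_terminal`: the bottom subextension of
  `F̄/F`), so the type of Example 5.1 (v)'s labelling data is inhabited on a closed term of genuine arithmetic
  origin, with `𝕍_mod = 𝕍(F_mod)`;
* `PrimeLabelling.nonempty_model_along_at` / `exists_model_along` — the same over a GENERAL `†𝒟^⊛ = ℬ(G)⁰` with
  `ρ : π₁(†𝒟^⊛) ↠ G_F` (`GlobalDivisorData.arithAlong F ρ hρ`, the form the NF-bridge consumers instantiate):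
  `𝕍_mod :=` the places of "the corresponding subfield" of the terminal object.

HONEST LABEL: `_model` — genuine printed objects (effective arithmetic divisors of number fields, their primes,
their places); nothing degenerate, nothing restated; `Vmod` is the place set of the terminal object's field (for
`arith F` that field IS `F`, recorded in `exists_model`).  A witness is consistency evidence only («type is
inhabited at the model»); nothing of [IUTchI] is asserted and no side is taken on [IUTchIII] Cor. 3.12.
-/

noncomputable section

namespace Literature.IUT.HodgeTheaters

open CategoryTheory CategoryTheory.Limits Opposite Literature.AlgebraicGeometry.Frobenioids
open Literature.AlgebraicGeometry.Frobenioids.QuasiTemperoid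

namespace PrimeLabelling

variable (F : Type) [Field F] [NumberField F]

/-- **IUTchI:Ex5.1(v)** (kurims p.129 l.52–62) GENUINE MODEL, at every terminal object: over the arithmetic divisor
data `arith F` on `ℬ(G_F)⁰`, for each terminal `A₀` ("`C_{F_mod}`") the labelling interface
`PrimeLabelling (arith F) 𝕍` is inhabited with `𝕍 :=` the places of the number field of `A₀` — the bijection
`Prime(Φ^⊛(A₀)) ≃ 𝕍` is [FrdI] Ex 6.3's `v ↦ [v]` (abc-iut-L1 `Ex63_primes_holds`, via `arith_primes_terminal`)
inverted. `_model`. [claim: Mochizuki2012, status: disputed] -/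
theorem nonempty_model_at {A₀ : BaseCat (absGalGrp F)} (hA₀ : IsTerminal A₀) :
    Nonempty (PrimeLabelling (GlobalDivisorData.arith F) (Places ↥((galoisSubextOfFinite F).obj A₀).L)) := by
  obtain ⟨hprim, hbij⟩ := (arith_primes_terminal F hA₀).1
  exact ⟨{ A₀ := A₀, isTerminal := hA₀, equiv := (Equiv.ofBijective _ hbij).symm }⟩

/-- **IUTchI:Ex5.1(v)** (kurims p.129 l.52–62) GENUINE MODEL on a closed term: `†𝒟^⊛ = ℬ(G_F)⁰` HAS a terminal
object (`exists_isTerminal_baseCat`: the one-point `G_F`-set), its number field is `F = F_mod` itself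
(`arith_field_terminal`: the bottom subextension `⊥` of `F̄/F`), and there the labelling data
`Prime(†ℱ^⊛_mod) ⥲ 𝕍_mod` is inhabited with `𝕍_mod = 𝕍(F_mod)`. `_model`. [claim: Mochizuki2012, status: disputed] -/
theorem exists_model :
    ∃ A₀ : BaseCat (absGalGrp F), Nonempty (IsTerminal A₀) ∧ ((galoisSubextOfFinite F).obj A₀).L = ⊥ ∧
      Nonempty (PrimeLabelling (GlobalDivisorData.arith F) (Places ↥((galoisSubextOfFinite F).obj A₀).L)) := by
  obtain ⟨A₀, ⟨hA₀⟩⟩ := exists_isTerminal_baseCat (absGalGrp F)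
  exact ⟨A₀, ⟨hA₀⟩, arith_field_terminal F hA₀, nonempty_model_at F hA₀⟩

/-- **IUTchI:Ex5.1(v)** (kurims p.129 l.52–62) the labelled set is in bijection with the primes of the divisor
monoid at the terminal object (restated as a bare `Nonempty (… ≃ …)` for consumers that only want the equivalence):
`Prime(Φ^⊛(A₀)) ≃ 𝕍(number field of A₀)`. `_model`. [claim: Mochizuki2012, status: disputed] -/
theorem nonempty_primeAt_equiv_places (A₀ : BaseCat (absGalGrp F)) :
    Nonempty ((GlobalDivisorData.arith F).PrimeAt A₀ ≃ Places ↥((galoisSubextOfFinite F).obj A₀).L) := by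
  obtain ⟨hprim, hbij⟩ := Ex63_primes_holds ↥((galoisSubextOfFinite F).obj A₀).L
  exact ⟨(Equiv.ofBijective _ hbij).symm⟩

section Along

variable {G : ProfiniteGrp.{0}} (ρ : G →ₜ* GalFbar F) (hρ : Function.Surjective ρ)

/-- **IUTchI:Ex5.1(v)** (kurims p.129 l.52–62) GENUINE MODEL over a GENERAL `†𝒟^⊛ = ℬ(G)⁰`, `ρ : π₁(†𝒟^⊛) ↠ G_F`
(divisor data `arithAlong F ρ hρ`, abc-iut-w4-d050): at every terminal object `A₀` the labelling interface is
inhabited with `𝕍 :=` the places of "the corresponding subfield `𝕄̄^⊛(†𝒟^⊚)^{A₀}`" (`subfieldFunctor`), the bijection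
being [FrdI] Ex 6.3's (`Ex63_primes_holds`) inverted. `_model`. [claim: Mochizuki2012, status: disputed] -/
theorem nonempty_model_along_at {A₀ : BaseCat G} (hA₀ : IsTerminal A₀) :
    Nonempty (PrimeLabelling (GlobalDivisorData.arithAlong F ρ hρ)
      (Places ↥((subfieldFunctor F ρ hρ).obj A₀).L)) := by
  obtain ⟨hprim, hbij⟩ := Ex63_primes_holds ↥((subfieldFunctor F ρ hρ).obj A₀).L
  exact ⟨{ A₀ := A₀, isTerminal := hA₀, equiv := (Equiv.ofBijective _ hbij).symm }⟩

/-- **IUTchI:Ex5.1(v)** (kurims p.129 l.52–62) … and `ℬ(G)⁰` has a terminal object (`exists_isTerminal_baseCat`),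
so over every `(G, ρ)` the Example 5.1 (v) labelling data along `ρ` is inhabited on genuine arithmetic data.
`_model`. [claim: Mochizuki2012, status: disputed] -/
theorem exists_model_along :
    ∃ A₀ : BaseCat G, Nonempty (IsTerminal A₀) ∧
      Nonempty (PrimeLabelling (GlobalDivisorData.arithAlong F ρ hρ)
        (Places ↥((subfieldFunctor F ρ hρ).obj A₀).L)) := by
  obtain ⟨A₀, ⟨hA₀⟩⟩ := exists_isTerminal_baseCat G
  exact ⟨A₀, ⟨hA₀⟩, nonempty_model_along_at F ρ hρ hA₀⟩

/-- The hypotheses `(G, ρ, hρ)` of the general form are themselves satisfiable (`G := G_F`, `ρ := id`;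
cf. abc-iut-w4-d050's `exists_profinite_surjective_toGal`), so `exists_model_along` is never about an empty family:
some `(G, ρ)` and some terminal `A₀` carry the labelling data. `_model`. [claim: Mochizuki2012, status: disputed] -/
theorem exists_model_along_some :
    ∃ (G : ProfiniteGrp.{0}) (ρ : G →ₜ* GalFbar F) (hρ : Function.Surjective ρ) (A₀ : BaseCat G),
      Nonempty (IsTerminal A₀) ∧
        Nonempty (PrimeLabelling (GlobalDivisorData.arithAlong F ρ hρ)
          (Places ↥((subfieldFunctor F ρ hρ).obj A₀).L)) := by
  refine ⟨absGalGrp F, ContinuousMonoidHom.id (GalFbar F), fun x => ⟨x, rfl⟩, ?_⟩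
  exact exists_model_along F _ _

end Along

end PrimeLabelling

end Literature.IUT.HodgeTheaters

end
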